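import Mathlib.Analysis.InnerProductSpace.l2Space
import Mathlib.LinearAlgebra.Basis.Basic
import Literature.Barriers.CriticalPhenomena.SAWNoUnitaryCFT
import HarnessLib

/-!
# Barrier, narrowed: at `c = 0` unitarity trivialises VIRASORO highest-weight structure only —
# the global conformal (Möbius) algebra realises every weight `h ≥ 0` unitarily

Barrier catalogue `Literature/Barriers/CriticalPhenomena/` (D-0021), companion of `SAWNoUnitaryCFT`
(Gomes' triviality theorem, PROVED there: at `c = 0` every non-zero primary vector of a
positive-definite representation of the Virasoro algebra with `L_n† = L_{-n}` has weight `h = 0`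
and spans a trivial representation). Outcome of the barrier audit of 2026-08-15 (refuter,
D-0021 "barrier-audit"): the theorem is confirmed — it is the argument printed by
Kac–Raina–Rozhkovskaya (Lecture 8, §8.4: level-`2N` determinant `4N³h²(8h - 5N)`), and the recent
probabilistic constructions on the SAW side are exactly as non-unitary as it predicts (the
Virasoro representation of central charge `c(8/3) = 0` built from Werner's self-avoiding loop
measure is hermitian only for an INDEFINITE form [GordinaQianWang2025, Thm 1.1 and Prop. 2.9];
its Shapovalov form "is distinct from the `L²(ν)`-inner product, which is a symptom of the
non-unitarity of the theory" [BaverezJego2024, p. 3]) — but the catalogued `technique_class`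
("reflection-positivity … unitary-conformal-bootstrap OS-positivity") was wider than what the
theorem quantifies over. Gomes' argument uses the modes `L_{±n}`, `n ≥ 2` (for the SAW weights:
`L_{±2}` at level two for `h ∈ (0, 5/8)`, `L_{±2}, L_{±4}` at level four for `h = 5/8`), i.e. a
local stress tensor extending the global conformal symmetry to the Virasoro algebra, together with
the highest-weight (positive-energy) condition. Neither Hilbert-space positivity alone nor
positivity plus GLOBAL conformal symmetry is obstructed at "`c = 0`": the central charge does not
even enter the relations of `sl₂ = ⟨L_{-1}, L_0, L_1⟩` (`m³ - m = 0` for `|m| ≤ 1`).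

Formal content (proved). `UnitaryMoebiusRep`: the three Möbius generators on a complex
inner-product space with the `sl₂` relations and `L_1† = L_{-1}`, `L_0† = L_0`; every
`UnitaryVirasoroRep` restricts to one (`UnitaryVirasoroRep.toMoebius`) and primaries restrict to
quasi-primaries. `UnitaryMoebiusRep.weight_nonneg`: a non-zero quasi-primary vector has `h ≥ 0`
(level one, as for Virasoro). `discreteSeries`: for every `h ≥ 0` the holomorphic discrete series
`D_h⁺` — on the algebraic span of an orthonormal sequence `(u_k)`, `L_{-1}u_k = a_k u_{k+1}`,
`L_1 u_{k+1} = a_k u_k`, `L_1 u_0 = 0`, `L_0 u_k = (h + k)u_k`, `a_k = √((k+1)(2h+k))` — is a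
`UnitaryMoebiusRep` with quasi-primary vector `u_0 ≠ 0` of weight `h`
(`moebiusUnitarilyRealisable_iff : MoebiusUnitarilyRealisable h ↔ 0 ≤ h`, realised inside
`ℓ²(ℕ, ℂ)`). `SAWNoUnitaryCFTNarrow` (proved, `SAWNoUnitaryCFTNarrow_holds`): the conjunction of
`SAWNoUnitaryCFT` with these facts, in particular the printed SAW weights `1/3` (bulk energy /
two-leg), `5/8` (boundary one-leg) and `5/96` (half the one-leg exponent) are unitarily realisable
for the Möbius algebra and not for the Virasoro algebra at `c = 0`.

## References (page-level, audit 2026-08-15)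

* V. G. Kac, A. K. Raina, N. Rozhkovskaya, *Bombay Lectures on Highest Weight Representations of
  Infinite Dimensional Lie Algebras*, 2nd ed. (2013): Lecture 1, Prop. 1.2 (the tensor-density
  modules `V'_{α,β}` of the Witt algebra carry a UNITARY contravariant form iff `β + β̄ = 1`,
  `α + β ∈ ℝ` — non-trivial unitary `c = 0` modules, not of highest weight); Lecture 2, §2.1
  ("`Vir` has nontrivial positive-energy unitary representations only if `C ≠ 0`"); Lecture 3,
  Prop. 3.5 (`c ≥ 0`, `h ≥ 0`); Lecture 8, §8.4 ("A simple argument due to Gomes … for `c = 0` the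
  only unitary highest weight representation of `Vir` is the trivial representation … Evaluating
  the determinant for `c = 0` we obtain `4N³h²(8h-5N)`") [KacRainaRozhkovskaya2013].
* M. Gordina, W. Qian, Y. Wang, J. Math. Pures Appl. 195 (2025) 103669: Thm 1.1 = Thm 4.6
  (`L_k† = L_{-k}` on `L²_τ(Loop, μ^c)`, SLE_κ loop measure, `c = c(κ) ≤ 1`, `τ : z ↦ 1/z̄`),
  Prop. 2.9 and its proof ("positive definite on `𝓕⁺ × 𝓕⁺` and negative definite on `𝓕⁻ × 𝓕⁻`";
  "(indefinite) unitary") [GordinaQianWang2025].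
* G. Baverez, A. Jego, arXiv:2407.09080, p. 3 and §8.1 pp. 51–52 ("[BJ25] is the first proof that
  the SLE loop measure (hence any Kontsevich–Suhov measure) is an Airault–Malliavin measure", with
  `c_L = 26 - c_m`) [BaverezJego2024]; arXiv:2502.17076, eq. (1.1) and Thm 1.2 [BaverezJego2025].
* D. J. Binder, S. Rychkov, JHEP 04 (2020) 117: Thm 7.2, Prop. 7.3 and the paragraph after
  Prop. 7.4 ("any `O(n)` model for non-integer `n` is necessarily non-unitary … we cannot use the
  most robust numerical bootstrap techniques … as these require positivity") [BinderRychkov2020].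
* R. Friedrich, W. Werner, Comm. Math. Phys. 243 (2003), §5.2–§5.3 (restriction measures give
  highest-weight representations of the Witt algebra, `h` = restriction exponent; two-sided
  restriction measures exist only for `h ≥ 5/8`; positivity there is positivity of the functions
  `B_n^{(h)}`) [FriedrichWerner2003].
* J. Miller, S. Sheffield, PTRF 164 (2016), Thm 1.1 and Thm 1.2 (for `κ ∈ (0,4)` the flow line of
  `e^{ih/χ}`, `h` a GFF, is an SLE_κ, almost surely determined by `h`) [MillerSheffield2016].
* N. Madras, G. Slade, *The Self-Avoiding Walk* (1993), §1.6 notes to §1.5, p. 33 (infrared bound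
  from reflection positivity for spin systems; for the SAW "neither the infrared bound nor the
  bubble condition were known to hold in any dimension" before the lace expansion) [MadrasSlade1993].
-/

noncomputable section

open scoped ComplexInnerProductSpace
open Complex Module Submodule

namespace Literature.Barriers.CriticalPhenomena

namespace UnitaryCFT

variable {V : Type*} [NormedAddCommGroup V] [InnerProductSpace ℂ V]

/-! ### The wider technique class: unitary representations of the Möbius algebra `sl₂` -/

/-- A **unitary representation of the global conformal (Möbius) algebra**
`sl₂ = ⟨L_{-1}, L_0, L_1⟩` on a complex inner-product space (positive definite): three
everywhere-defined linear maps `Lneg = L_{-1}`, `Lzero = L_0`, `Lpos = L_1` with the relations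
`[L_0, L_{-1}] = L_{-1}`, `[L_0, L_1] = -L_1`, `[L_1, L_{-1}] = 2L_0` — the Virasoro relations
`[L_m, L_n] = (m-n)L_{m+n} + (c/12)(m³-m)δ_{m+n,0}` restricted to `m, n ∈ {-1, 0, 1}`, where the
central term vanishes identically (`m³ = m`), so that no central charge appears — and hermiticity
`L_1† = L_{-1}`, `L_0† = L_0`. This is the symmetry datum of a reflection-positive theory with
GLOBAL conformal covariance only (quasi-primary fields), the setting of the `d`-dimensional
unitary conformal bootstrap. [cite: KacRainaRozhkovskaya2013, Lecture 1 §1.3 eq. (1.18) (relations) and Lecture 3 §3.2 (ω(d_n) = d_{-n})] -/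
structure UnitaryMoebiusRep (V : Type*) [NormedAddCommGroup V] [InnerProductSpace ℂ V] where
  /-- `L_{-1}` (translation). -/
  Lneg : V →ₗ[ℂ] V
  /-- `L_0` (dilation). -/
  Lzero : V →ₗ[ℂ] V
  /-- `L_1` (special conformal transformation). -/
  Lpos : V →ₗ[ℂ] V
  /-- `[L_0, L_{-1}] = L_{-1}`. -/
  lie_zero_neg : ∀ x : V, Lzero (Lneg x) - Lneg (Lzero x) = Lneg x
  /-- `[L_0, L_1] = -L_1`. -/
  lie_zero_pos : ∀ x : V, Lzero (Lpos x) - Lpos (Lzero x) = -Lpos x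
  /-- `[L_1, L_{-1}] = 2L_0`. -/
  lie_pos_neg : ∀ x : V, Lpos (Lneg x) - Lneg (Lpos x) = (2 : ℂ) • Lzero x
  /-- `L_1† = L_{-1}`. -/
  adjoint_pos : ∀ x y : V, ⟪Lpos x, y⟫ = ⟪x, Lneg y⟫
  /-- `L_0† = L_0`. -/
  adjoint_zero : ∀ x y : V, ⟪Lzero x, y⟫ = ⟪x, Lzero y⟫

/-- A **quasi-primary vector** of weight `h`: `L_1 v = 0` and `L_0 v = h v` (a primary vector for
the Möbius algebra). [cite: KacRainaRozhkovskaya2013, Lecture 3 §3.2 (highest-weight vector: d_0 v = h v, d_n v = 0 for n > 0)] -/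
structure UnitaryMoebiusRep.IsQuasiPrimary (R : UnitaryMoebiusRep V) (v : V) (h : ℝ) : Prop where
  /-- `L_1 v = 0`. -/
  annihilated : R.Lpos v = 0
  /-- `L_0 v = h v`. -/
  weight : R.Lzero v = (h : ℂ) • v

/-- Every unitary representation of the Virasoro algebra (`UnitaryVirasoroRep`, the technique class
of `SAWNoUnitaryCFT`) restricts to a unitary representation of the Möbius algebra: the central term
`(c/12)(m³ - m)` vanishes for `m ∈ {-1, 0, 1}`. (The Möbius class is the WIDER class.)
[cite: KacRainaRozhkovskaya2013, Lecture 1 §1.3 eq. (1.18)] -/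
def UnitaryVirasoroRep.toMoebius (R : UnitaryVirasoroRep V) : UnitaryMoebiusRep V where
  Lneg := R.L (-1)
  Lzero := R.L 0
  Lpos := R.L 1
  lie_zero_neg x := by
    have h := R.lie 0 (-1) x
    simpa using h
  lie_zero_pos x := by
    have h := R.lie 0 1 x
    simp only [Int.cast_zero, Int.cast_one, zero_sub, zero_add, one_ne_zero, ↓reduceIte, zero_smul,
      add_zero, neg_smul, one_smul] at h
    simpa using h
  lie_pos_neg x := by
    have h := R.lie 1 (-1) x
    simp only [Int.cast_one, Int.cast_neg, sub_neg_eq_add, add_neg_cancel, ↓reduceIte] at h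
    rw [h]
    norm_num
  adjoint_pos x y := R.adjoint 1 x y
  adjoint_zero x y := by simpa using R.adjoint 0 x y

/-- A Virasoro primary vector is a quasi-primary vector of the restricted Möbius representation.
[cite: KacRainaRozhkovskaya2013, Lecture 3 §3.2] -/
theorem UnitaryVirasoroRep.IsPrimary.toQuasiPrimary {R : UnitaryVirasoroRep V} {v : V} {h : ℝ}
    (hv : R.IsPrimary v h) : R.toMoebius.IsQuasiPrimary v h :=
  ⟨hv.annihilated 1 one_pos, hv.weight⟩

namespace UnitaryMoebiusRep

/-- Positivity of the inner product (real part of `⟪x, x⟫`); a thin in-file wrapper of Mathlib's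
`inner_self_nonneg`. [folklore] -/
private theorem inner_self_real_nonneg (x : V) : 0 ≤ (⟪x, x⟫).re := by
  have h := @inner_self_nonneg ℂ V _ _ _ x
  simpa using h

/-- `⟪x, x⟫ = ‖x‖²`; a thin in-file wrapper of Mathlib's `inner_self_eq_norm_sq_to_K`. [folklore] -/
private theorem inner_self_eq_normSq (x : V) : ⟪x, x⟫ = ((‖x‖ ^ 2 : ℝ) : ℂ) := by
  rw [inner_self_eq_norm_sq_to_K]; push_cast; rfl

/-- Level one for the Möbius algebra: `‖L_{-1}v‖² = 2h‖v‖²` for a quasi-primary `v`, hence a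
non-zero quasi-primary vector has `h ≥ 0` — the ONLY constraint unitarity places on a weight when
only the global conformal algebra acts (cf. `discreteSeries`).
[cite: KacRainaRozhkovskaya2013, Lecture 3 Prop. 3.5 (h ≥ 0 from level one)] -/
theorem weight_nonneg (R : UnitaryMoebiusRep V) {v : V} {h : ℝ} (hv : R.IsQuasiPrimary v h)
    (hv0 : v ≠ 0) : 0 ≤ h := by
  have h1 : R.Lpos (R.Lneg v) = ((2 * h : ℝ) : ℂ) • v := by
    have := R.lie_pos_neg v
    rw [hv.annihilated, map_zero, sub_zero, hv.weight, smul_smul] at this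
    rw [this, show ((2 * h : ℝ) : ℂ) = 2 * (h : ℂ) by push_cast; ring]
  have key : ⟪R.Lneg v, R.Lneg v⟫ = ((2 * h : ℝ) : ℂ) * ⟪v, v⟫ := by
    rw [← R.adjoint_pos, h1, inner_smul_left, Complex.conj_ofReal]
  have hw := inner_self_real_nonneg (R.Lneg v)
  rw [key, inner_self_eq_normSq, ← Complex.ofReal_mul, Complex.ofReal_re] at hw
  have hpos : 0 < ‖v‖ ^ 2 := by positivity
  nlinarith

end UnitaryMoebiusRep

/-! ### Sesquilinear extension from a basis -/

/-- Two linear maps `S, T` on an inner-product space with a (Hamel) basis `b` satisfy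
`⟪S x, y⟫ = ⟪x, T y⟫` for all `x, y` as soon as they do on basis vectors. [folklore] -/
theorem inner_map_eq_of_basis {ι : Type*} (b : Basis ι ℂ V) (S T : V →ₗ[ℂ] V)
    (hST : ∀ i j, ⟪S (b i), b j⟫ = ⟪b i, T (b j)⟫) (x y : V) : ⟪S x, y⟫ = ⟪x, T y⟫ := by
  have step : ∀ j, ∀ x, ⟪S x, b j⟫ = ⟪x, T (b j)⟫ := by
    intro j
    have hlin : (innerₛₗ ℂ (b j)).comp S = innerₛₗ ℂ (T (b j)) :=
      b.ext fun i => by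
        simp only [LinearMap.comp_apply, innerₛₗ_apply_apply]
        rw [← inner_conj_symm, hST i j, inner_conj_symm]
    intro x
    have hx := LinearMap.congr_fun hlin x
    simp only [LinearMap.comp_apply, innerₛₗ_apply_apply] at hx
    rw [← inner_conj_symm, hx, inner_conj_symm]
  have hlin : innerₛₗ ℂ (S x) = (innerₛₗ ℂ x).comp T :=
    b.ext fun j => by
      simp only [LinearMap.comp_apply, innerₛₗ_apply_apply]
      exact step j x
  have hy := LinearMap.congr_fun hlin y
  simpa only [LinearMap.comp_apply, innerₛₗ_apply_apply] using hy

/-! ### The holomorphic discrete series `D_h⁺` of `sl₂` on the span of an orthonormal sequence -/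

section DiscreteSeries

variable {E : Type*} [NormedAddCommGroup E] [InnerProductSpace ℂ E] {e : ℕ → E}

/-- The matrix coefficient `a_k = √((k+1)(2h+k))` of `L_{∓1}` between the normalised weight vectors
`u_k`, `u_{k+1}` of `D_h⁺` (`‖L_{-1}u_k‖² = (k+1)(2h+k)`, from `[L_1, L_{-1}] = 2L_0`). [folklore] -/
def dsCoef (h : ℝ) (k : ℕ) : ℝ := Real.sqrt ((k + 1) * (2 * h + k))

/-- `a_k² = (k+1)(2h+k)` for `h ≥ 0`. [folklore] -/
theorem dsCoef_mul_self {h : ℝ} (hh : 0 ≤ h) (k : ℕ) :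
    dsCoef h k * dsCoef h k = (k + 1) * (2 * h + k) :=
  Real.mul_self_sqrt (by positivity)

/-- The representation space of `D_h⁺`: the algebraic (incomplete) span of an orthonormal sequence
`e : ℕ → E` — the generators are unbounded, so they are everywhere defined only on such a
pre-Hilbert space. [folklore] -/
abbrev dsSpace (e : ℕ → E) : Submodule ℂ E := span ℂ (Set.range e)

/-- The orthonormal sequence as a Hamel basis `(u_k)` of its span. [folklore] -/
def dsBasis (he : Orthonormal ℂ e) : Basis ℕ ℂ (dsSpace e) := Basis.span he.linearIndependent

/-- `u_k = e_k` as vectors of `E`. [folklore] -/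
theorem dsBasis_coe (he : Orthonormal ℂ e) (k : ℕ) : ((dsBasis he k : dsSpace e) : E) = e k := by
  simp [dsBasis, Basis.span_apply]

/-- `⟪u_i, u_j⟫ = δ_{ij}`. [folklore] -/
theorem inner_dsBasis (he : Orthonormal ℂ e) (i j : ℕ) :
    ⟪dsBasis he i, dsBasis he j⟫ = if i = j then (1 : ℂ) else 0 := by
  rw [Submodule.coe_inner, dsBasis_coe, dsBasis_coe]
  convert orthonormal_iff_ite.mp he i j

/-- `L_{-1}`: `u_k ↦ a_k u_{k+1}`. [folklore] -/
def dsNeg (he : Orthonormal ℂ e) (h : ℝ) : dsSpace e →ₗ[ℂ] dsSpace e :=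
  (dsBasis he).constr ℂ fun k => ((dsCoef h k : ℝ) : ℂ) • dsBasis he (k + 1)

/-- The images `L_1 u_0 = 0`, `L_1 u_{k+1} = a_k u_k`. [folklore] -/
def dsPosVec (he : Orthonormal ℂ e) (h : ℝ) : ℕ → dsSpace e
  | 0 => 0
  | k + 1 => ((dsCoef h k : ℝ) : ℂ) • dsBasis he k

/-- `L_1`: `u_0 ↦ 0`, `u_{k+1} ↦ a_k u_k`. [folklore] -/
def dsPos (he : Orthonormal ℂ e) (h : ℝ) : dsSpace e →ₗ[ℂ] dsSpace e :=
  (dsBasis he).constr ℂ (dsPosVec he h)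

/-- `L_0`: `u_k ↦ (h + k) u_k`. [folklore] -/
def dsZero (he : Orthonormal ℂ e) (h : ℝ) : dsSpace e →ₗ[ℂ] dsSpace e :=
  (dsBasis he).constr ℂ fun k => ((h + k : ℝ) : ℂ) • dsBasis he k

variable (he : Orthonormal ℂ e) (h : ℝ)

/-- `L_{-1} u_k = a_k u_{k+1}`. [folklore] -/
@[simp] theorem dsNeg_basis (k : ℕ) :
    dsNeg he h (dsBasis he k) = ((dsCoef h k : ℝ) : ℂ) • dsBasis he (k + 1) := by
  simp [dsNeg, Basis.constr_basis]

/-- `L_1 u_0 = 0`. [folklore] -/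
@[simp] theorem dsPos_basis_zero : dsPos he h (dsBasis he 0) = 0 := by
  simp [dsPos, Basis.constr_basis, dsPosVec]

/-- `L_1 u_{k+1} = a_k u_k`. [folklore] -/
@[simp] theorem dsPos_basis_succ (k : ℕ) :
    dsPos he h (dsBasis he (k + 1)) = ((dsCoef h k : ℝ) : ℂ) • dsBasis he k := by
  simp [dsPos, Basis.constr_basis, dsPosVec]

/-- `L_0 u_k = (h + k) u_k`. [folklore] -/
@[simp] theorem dsZero_basis (k : ℕ) :
    dsZero he h (dsBasis he k) = ((h + k : ℝ) : ℂ) • dsBasis he k := by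
  simp [dsZero, Basis.constr_basis]

/-- `[L_0, L_{-1}] = L_{-1}` on `D_h⁺`. [folklore] -/
theorem ds_lie_zero_neg (x : dsSpace e) :
    dsZero he h (dsNeg he h x) - dsNeg he h (dsZero he h x) = dsNeg he h x := by
  have key : (dsZero he h) ∘ₗ (dsNeg he h) - (dsNeg he h) ∘ₗ (dsZero he h) = dsNeg he h := by
    refine (dsBasis he).ext fun k => ?_
    simp only [LinearMap.sub_apply, LinearMap.comp_apply, dsNeg_basis, dsZero_basis, map_smul,
      smul_smul]
    rw [← sub_smul]
    congr 1
    push_cast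
    ring
  exact LinearMap.congr_fun key x

/-- `[L_0, L_1] = -L_1` on `D_h⁺`. [folklore] -/
theorem ds_lie_zero_pos (x : dsSpace e) :
    dsZero he h (dsPos he h x) - dsPos he h (dsZero he h x) = -dsPos he h x := by
  have key : (dsZero he h) ∘ₗ (dsPos he h) - (dsPos he h) ∘ₗ (dsZero he h) = -dsPos he h := by
    refine (dsBasis he).ext fun k => ?_
    cases k with
    | zero => simp
    | succ j =>
      simp only [LinearMap.sub_apply, LinearMap.comp_apply, LinearMap.neg_apply, dsPos_basis_succ,
        dsZero_basis, map_smul, smul_smul]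
      rw [← sub_smul, ← neg_smul]
      congr 1
      push_cast
      ring
  exact LinearMap.congr_fun key x

/-- `[L_1, L_{-1}] = 2L_0` on `D_h⁺` (uses `a_k² = (k+1)(2h+k)`, i.e. `h ≥ 0`). [folklore] -/
theorem ds_lie_pos_neg (hh : 0 ≤ h) (x : dsSpace e) :
    dsPos he h (dsNeg he h x) - dsNeg he h (dsPos he h x) = (2 : ℂ) • dsZero he h x := by
  have key : (dsPos he h) ∘ₗ (dsNeg he h) - (dsNeg he h) ∘ₗ (dsPos he h) =
      (2 : ℂ) • dsZero he h := by
    refine (dsBasis he).ext fun k => ?_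
    cases k with
    | zero =>
      simp only [LinearMap.sub_apply, LinearMap.comp_apply, LinearMap.smul_apply, dsNeg_basis,
        dsPos_basis_zero, dsPos_basis_succ, dsZero_basis, map_smul, map_zero, sub_zero, smul_smul]
      rw [← Complex.ofReal_mul, dsCoef_mul_self hh 0]
      congr 1
      push_cast
      ring
    | succ j =>
      simp only [LinearMap.sub_apply, LinearMap.comp_apply, LinearMap.smul_apply, dsNeg_basis,
        dsPos_basis_succ, dsZero_basis, map_smul, smul_smul]
      rw [← sub_smul, ← Complex.ofReal_mul, ← Complex.ofReal_mul, dsCoef_mul_self hh (j + 1),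
        dsCoef_mul_self hh j]
      congr 1
      push_cast
      ring
  exact LinearMap.congr_fun key x

/-- `⟪L_1 u_i, u_j⟫ = ⟪u_i, L_{-1} u_j⟫` (the coefficients `a_k` are real). [folklore] -/
theorem dsPos_adjoint_basis (i j : ℕ) :
    ⟪dsPos he h (dsBasis he i), dsBasis he j⟫ = ⟪dsBasis he i, dsNeg he h (dsBasis he j)⟫ := by
  rw [dsNeg_basis, inner_smul_right, inner_dsBasis]
  cases i with
  | zero =>
    rw [dsPos_basis_zero, inner_zero_left, if_neg (by omega), mul_zero]
  | succ i =>
    rw [dsPos_basis_succ, inner_smul_left, Complex.conj_ofReal, inner_dsBasis]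
    by_cases hij : i = j
    · subst hij; simp
    · rw [if_neg hij, if_neg (by omega), mul_zero, mul_zero]

/-- `⟪L_0 u_i, u_j⟫ = ⟪u_i, L_0 u_j⟫` (the weights `h + k` are real). [folklore] -/
theorem dsZero_adjoint_basis (i j : ℕ) :
    ⟪dsZero he h (dsBasis he i), dsBasis he j⟫ = ⟪dsBasis he i, dsZero he h (dsBasis he j)⟫ := by
  rw [dsZero_basis, dsZero_basis, inner_smul_left, inner_smul_right, Complex.conj_ofReal,
    inner_dsBasis]
  by_cases hij : i = j
  · subst hij; simp
  · rw [if_neg hij, mul_zero, mul_zero]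

/-- **The discrete series `D_h⁺` of `sl₂` is a unitary Möbius representation for every `h ≥ 0`.**
[folklore] -/
def discreteSeries (hh : 0 ≤ h) : UnitaryMoebiusRep (dsSpace e) where
  Lneg := dsNeg he h
  Lzero := dsZero he h
  Lpos := dsPos he h
  lie_zero_neg := ds_lie_zero_neg he h
  lie_zero_pos := ds_lie_zero_pos he h
  lie_pos_neg := ds_lie_pos_neg he h hh
  adjoint_pos := inner_map_eq_of_basis (dsBasis he) _ _ (dsPos_adjoint_basis he h)
  adjoint_zero := inner_map_eq_of_basis (dsBasis he) _ _ (dsZero_adjoint_basis he h)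

/-- `u_0` is a quasi-primary vector of weight `h` of `D_h⁺`. [folklore] -/
theorem discreteSeries_isQuasiPrimary (hh : 0 ≤ h) :
    (discreteSeries he h hh).IsQuasiPrimary (dsBasis he 0) h :=
  ⟨dsPos_basis_zero he h, by simp [discreteSeries]⟩

end DiscreteSeries

/-! ### Möbius-unitary realisability of a weight -/

/-- **`MoebiusUnitarilyRealisable h`**: the weight `h` is carried by a non-zero quasi-primary
vector of SOME unitary representation of the Möbius algebra on a complex inner-product space —
what a reflection-positive, globally conformally covariant theory with a quasi-primary field of
weight `h` provides (compare `UnitarilyRealisable c h`, which asks for the full Virasoro algebra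
at central charge `c`). [folklore] -/
def MoebiusUnitarilyRealisable (h : ℝ) : Prop :=
  ∃ (V : Type) (_ : NormedAddCommGroup V) (_ : InnerProductSpace ℂ V) (R : UnitaryMoebiusRep V)
    (v : V), v ≠ 0 ∧ R.IsQuasiPrimary v h

/-- Virasoro-unitary realisability (at any central charge) implies Möbius-unitary realisability.
[cite: KacRainaRozhkovskaya2013, Lecture 1 §1.3 eq. (1.18)] -/
theorem UnitarilyRealisable.moebius {c h : ℝ} (H : UnitarilyRealisable c h) :
    MoebiusUnitarilyRealisable h := by
  obtain ⟨V, _, _, R, v, -, hv0, hv⟩ := H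
  exact ⟨V, inferInstance, inferInstance, R.toMoebius, v, hv0, hv.toQuasiPrimary⟩

/-- **A weight is unitarily realisable for the Möbius algebra iff `h ≥ 0`** — necessity by level
one (`weight_nonneg`), sufficiency by the discrete series `D_h⁺` realised on the span of the
standard Hilbert basis of `ℓ²(ℕ, ℂ)`. In particular EVERY `h ≥ 0` occurs, at "any central
charge": the global conformal algebra does not see `c`. [folklore] -/
theorem moebiusUnitarilyRealisable_iff (h : ℝ) : MoebiusUnitarilyRealisable h ↔ 0 ≤ h := by
  constructor
  · rintro ⟨V, _, _, R, v, hv0, hv⟩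
    exact R.weight_nonneg hv hv0
  · intro hh
    let b : HilbertBasis ℕ ℂ (lp (fun _ : ℕ => ℂ) 2) := default
    exact ⟨dsSpace (⇑b), inferInstance, inferInstance, discreteSeries b.orthonormal h hh,
      dsBasis b.orthonormal 0, (dsBasis b.orthonormal).ne_zero 0,
      discreteSeries_isQuasiPrimary b.orthonormal h hh⟩

end UnitaryCFT

open UnitaryCFT

/-! ### The narrowed barrier -/

/-- **Barrier `SAWNoUnitaryCFT`, narrowed** (barrier audit, D-0021). What unitarity forbids at
`c = 0` is VIRASORO highest-weight structure, not Hilbert-space positivity and not global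
conformal symmetry: (1) `SAWNoUnitaryCFT` (Gomes: at `c = 0` every non-zero Virasoro primary of a
positive-definite representation with `L_n† = L_{-n}` has `h = 0`, all vacuum descendants vanish,
and the SAW weight `h_{1,3} = 1/3` is not realisable); (2) for the Möbius algebra
`⟨L_{-1}, L_0, L_1⟩` with the same hermiticity, a weight is unitarily realisable iff `h ≥ 0`
(`moebiusUnitarilyRealisable_iff`; sufficiency by the discrete series `D_h⁺`); (3) hence the
printed SAW weights — bulk energy / two-leg `1/3`, boundary one-leg `h_{2,1}(8/3) = 5/8`, half
the one-leg exponent `x_1/2 = 5/96` — ARE realisable by unitary Möbius representations and (4)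
are NOT realisable by unitary Virasoro representations at `c = 0`; (5) every unitary Virasoro
representation restricts to a unitary Möbius representation with the same `L_{-1}, L_0, L_1`
(the Virasoro class is the narrower one). The exclusion is produced exactly by the modes
`L_{±n}`, `n ≥ 2` — a local stress tensor of central charge `0` acting on the positive space
with the SAW operators as its primaries.

BARRIER (structured block, D-0021):
- technique_class: virasoro-unitary-highest-weight-at-c0 — positive-DEFINITE highest-weight (positive-energy) modules of the FULL Virasoro algebra with `L_n† = L_{-n}` and `c = 0` in which the SAW operators are primaries (`UnitaryVirasoroRep`, `UnitarilyRealisable 0 h`) [cite: KacRainaRozhkovskaya2013, Lecture 8 §8.4 (Gomes' argument) and Lecture 2 §2.1]; reflection positivity / OS positivity / the unitary numerical bootstrap are covered ONLY through this structure, i.e. when the positive Hilbert space carries a local stress tensor (Virasoro enhancement of the global conformal symmetry) of central charge `0` [cite: Cardy2013, §1 and §1.3]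
- blocks: as `SAWNoUnitaryCFT`: a unitary (reflection-positive) VIRASORO-covariant description of the scaling limit of `Literature.Probability.RandomPlanarGeometry.SAW.SAWScalingLimit` at `c = 0` carrying the printed SAW primaries (`h_{1,3} = 1/3`, `h_{2,1} = 5/8` [cite: Cardy2013, §1.4 and §3.2]) or a non-zero stress-tensor state, and positivity-based (unitary) numerical bootstrap bounds for the `n → 0` `O(n)` model [cite: Hikami2018, §1] [cite: BinderRychkov2020, Thm 7.2 and the discussion after Prop. 7.4]. NOT blocked (this theorem and the cited constructions): Hilbert-space positivity with global conformal symmetry only — every weight `h ≥ 0`, in particular `1/3`, `5/8`, `5/96`, is carried by a unitary Möbius representation (`moebiusUnitarilyRealisable_iff`, proved); unitary but non-highest-weight `c = 0` modules (the tensor-density modules `V'_{α,β}`, `β + β̄ = 1` [cite: KacRainaRozhkovskaya2013, Lecture 1 Prop. 1.2]); Virasoro actions hermitian for an INDEFINITE non-degenerate form on a genuine `L²` space of SAW-type loops [cite: GordinaQianWang2025, Thm 1.1 and Prop. 2.9]; a different Virasoro action on the same positive `L²` space at another central charge (the Kirillov/welding action on `L²` of the SLE_κ loop measure satisfies the Airault–Malliavin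 hermiticity with `c_L = 26 - c_m`, `= 26` for `κ = 8/3` [cite: BaverezJego2024, §8.1 pp. 51–52] [cite: BaverezJego2025, eq. (1.1) and Thm 1.2]); OS-positive ambient Gaussian fields carrying SLE_{8/3} as an almost surely determined non-local functional (flow lines of `e^{ih/χ}`, `h` a GFF, `κ ∈ (0,4)` [cite: MillerSheffield2016, Thm 1.1 and Thm 1.2])
- because: the `sl₂` relations contain no central term (`m³ - m = 0` for `|m| ≤ 1`) and the discrete series `D_h⁺` — `L_{-1}u_k = a_k u_{k+1}`, `L_1u_{k+1} = a_k u_k`, `L_0 u_k = (h+k)u_k`, `a_k² = (k+1)(2h+k) ≥ 0` on an orthonormal sequence `(u_k)` — is a positive-definite representation with `L_1† = L_{-1}` and quasi-primary `u_0` of weight `h` for every `h ≥ 0` (`discreteSeries`, proved); Gomes' contradiction needs the level-`2N` Gram matrix of `{L_{-N}²v, L_{-2N}v}`, determinant `4N³h²(8h-5N)` [cite: KacRainaRozhkovskaya2013, Lecture 8 §8.4], i.e. the generators `L_{±2}` (level two, excluding `0 < h < 5/8` [cite: DiFrancescoMathieuSenechal1997, eqs. (7.25)–(7.26)]) and `L_{±2},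 L_{±4}` (level four, excluding `h = 5/8`), together with the highest-weight condition: "Vir has nontrivial positive-energy unitary representations only if `C ≠ 0`" [cite: KacRainaRozhkovskaya2013, Lecture 2 §2.1], while without positive energy the Witt algebra has the unitary modules `V'_{α,β}` [cite: KacRainaRozhkovskaya2013, Lecture 1 Prop. 1.2]; on the SAW side the `c = 0` restriction representation is as printed: restriction measures give highest-weight representations of the Witt algebra with `h` the restriction exponent, degenerate at level two for `κ = 8/3`, `h = 5/8`, positivity being that of the functions `B_n^{(h)}` [cite: FriedrichWerner2003, §5.2–§5.3], and on `L²` of the SLE_κ loop measure (`κ = 8/3`: Werner's self-avoiding loops) `L_k† = L_{-k}` holds for the `τ`-twisted form, "positive definite on `𝓕⁺ × 𝓕⁺` and negative definite on `𝓕⁻ × 𝓕⁻`" [cite: GordinaQianWang2025, Prop. 2.9 and Thm 4.6], the Shapovalov form being "distinct from the `L²(ν)`-inner product, which is a symptom of the non-unitarity of the theory" [cite: BaverezJego2024, p. 3]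
- evasions_known: those of `SAWNoUnitaryCFT` (logarithmic `c = 0` CFT, `n → 0` limits, non-unitary determinant bootstrap, restriction / SLE_{8/3}, parafermionic observable) [cite: Cardy2013, §1.2 and §3] [cite: Hikami2018, §1]; plus: work with GLOBAL conformal covariance and positivity only (quasi-primary data, `sl₂` blocks), where `c` never enters and every `h ≥ 0` is admissible (this theorem); indefinite (Krein) hermiticity `L_k† = L_{-k}` on `L²` of the loop measure [cite: GordinaQianWang2025, Thm 1.1]; the welding (Kirillov) action, hermitian on the same `L²` space with `c_L = 26 - c_m` [cite: BaverezJego2024, §8.1] [cite: BaverezJego2025, Thm 1.2]; realise SLE_{8/3} inside the OS-positive free field (imaginary geometry) [cite: MillerSheffield2016, Thm 1.1 and Thm 1.2]; characterise the limit by conformal restriction instead of unitarity (restriction exponent `5/8`, two-sided restriction measures exist exactly for `h ≥ 5/8`) [cite: FriedrichWerner2003, §5.2] [cite: LawlerSchrammWerner2003Restriction, §1]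
- scope_caveats: what is PROVED here is `sl₂` representation theory (level one; the discrete series) and the restriction Virasoro → Möbius; the identification of SAW operators with (quasi-)primaries of the printed weights is the physics literature's [cite: Cardy2013, §1.4 and §3.2]; a reflection-positive lattice or continuum description of SAW correlations is neither exhibited nor excluded by either theorem — for the lattice SAW no reflection positivity is known (the infrared bound had to come from the lace expansion) [cite: MadrasSlade1993, §1.6 notes to §1.5 (p. 33)], and for non-integer `n` the `O(n)` CFT is non-unitary already in its singlet sector for reasons independent of `c` and of the dimension [cite: BinderRychkov2020, Thm 7.2 and Prop. 7.3] (its hypotheses exclude Jordan blocks of the dilation operator, Assumption 4, so the logarithmic `n = 0` point is covered by that theorem only in spirit); the `c_L = 26` hermiticity of [cite: BaverezJego2025, Thm 1.2] concerns the welding coordinates of the loop, not the SAW `N`-leg or energy operators, and is a preprint claim; Gomes' primary source (PLB 171, 1986) is read through [cite: KacRainaRozhkovskaya2013, Lecture 8 §8.4] (acquisition request acq-00630)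
- status: established (theorem, proved below; narrows the `technique_class` of `SAWNoUnitaryCFT`, audit 2026-08-15)
[cite: KacRainaRozhkovskaya2013, Lecture 8 §8.4 and Lecture 1 Prop. 1.2] -/
def SAWNoUnitaryCFTNarrow : Prop :=
  -- (1) the original barrier (Gomes; proved in `SAWNoUnitaryCFT_holds`)
  SAWNoUnitaryCFT ∧
  -- (2) Möbius unitarity constrains a quasi-primary weight exactly by `h ≥ 0`
  (∀ h : ℝ, MoebiusUnitarilyRealisable h ↔ 0 ≤ h) ∧
  -- (3) the printed SAW weights are Möbius-unitarily realisable …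
  (MoebiusUnitarilyRealisable sawEnergyWeight ∧
    MoebiusUnitarilyRealisable (sleBoundaryWeight (8 / 3)) ∧
    MoebiusUnitarilyRealisable (legExponent sawCoulombGas 1 / 2)) ∧
  -- (4) … and not Virasoro-unitarily realisable at `c = 0`
  (¬ UnitarilyRealisable 0 sawEnergyWeight ∧
    ¬ UnitarilyRealisable 0 (sleBoundaryWeight (8 / 3)) ∧
    ¬ UnitarilyRealisable 0 (legExponent sawCoulombGas 1 / 2)) ∧
  -- (5) the Virasoro class restricts into the Möbius class (same `L_{-1}, L_0, L_1`)
  (∀ (V : Type) [NormedAddCommGroup V] [InnerProductSpace ℂ V] (R : UnitaryVirasoroRep V),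
    ∃ M : UnitaryMoebiusRep V, M.Lneg = R.L (-1) ∧ M.Lzero = R.L 0 ∧ M.Lpos = R.L 1)

/-- The narrowed barrier holds (all conjuncts proved in this file and in `SAWNoUnitaryCFT`).
[cite: KacRainaRozhkovskaya2013, Lecture 8 §8.4] -/
theorem SAWNoUnitaryCFTNarrow_holds : SAWNoUnitaryCFTNarrow := by
  refine ⟨SAWNoUnitaryCFT_holds, moebiusUnitarilyRealisable_iff, ⟨?_, ?_, ?_⟩,
    ⟨SAWNoUnitaryCFT_holds.2.2.1, not_unitarilyRealisable_oneLeg_boundary.2,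
      not_unitarilyRealisable_oneLeg_boundary.1⟩, ?_⟩
  · exact (moebiusUnitarilyRealisable_iff _).2 (by norm_num [sawEnergyWeight, kacWeightZero])
  · exact (moebiusUnitarilyRealisable_iff _).2 (by norm_num [sleBoundaryWeight])
  · exact (moebiusUnitarilyRealisable_iff _).2 (by norm_num [legExponent, sawCoulombGas])
  · intro V _ _ R
    exact ⟨R.toMoebius, rfl, rfl, rfl⟩

/-- Corollary: Möbius-realisable but not Virasoro-realisable at `c = 0` — every `h > 0`.
[cite: KacRainaRozhkovskaya2013, Lecture 8 §8.4] -/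
theorem moebius_not_virasoro_of_pos {h : ℝ} (hh : 0 < h) :
    MoebiusUnitarilyRealisable h ∧ ¬ UnitarilyRealisable 0 h :=
  ⟨(moebiusUnitarilyRealisable_iff h).2 hh.le, not_unitarilyRealisable_of_ne_zero hh.ne'⟩

end Literature.Barriers.CriticalPhenomena
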